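/-
Copyright: literature port (parity-ideate cell, ROUND-19/20).  Trunk: AntSieve / parity.S13.
-/
import Literature.NumberTheory.Sieve.PolymathBoundedGapsCert
import Literature.Analysis.Convolution.ConvolutionPowerIntegerArithmetic
import HarnessLib

/-!
# Product-radial certificates for the Polymath 8b functional `M_{k,ε}` — analytic bridge and kernel checker

D. H. J. Polymath, *Variants of the Selberg sieve, and bounded intervals containing many primes*, Res. Math.
Sci. 1:12 (2014) = arXiv:1407.4897, Theorem 3.13 / eq. (35) (`M_{k,ε}`), Lemma 4.4 and §7 (numerics with
test functions built from one-variable profiles).  For finitely many pairs (profile `g_x`, radial polynomial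
`Q_x`) the test function is `F = 1_{(1+ε)·R_{k+1}} Φ`, `Φ(t) = Σ_x Q_x(1+ε − Σᵢ tᵢ) · ∏ᵢ g_x(tᵢ)`.

* Part B (real analysis, over the tree's `PolymathBoundedGapsCert` API: `cutoff`, `polymathI_cutoff`,
  `isPolymathTestFunction_cutoff`, `polymathJ_eq_of_inner`, `integral_Ioi_cutoff_insertNth`,
  `setIntegral_scaledSimplex_prodForm`, `hat`, `simplexFunctional`, `shiftCoeff`): closed forms
  `I(F) = Σ_{x,y} Σ_a (Q_xQ_y)_a Λ_{k+1,a,1+ε}(ĥ_{xy}^{k+1})`, `J_i(F) = Σ_{x,y} Σ_c [(V_xV_y)(X+2ε)]_c Λ_{k,c,1−ε}(ĥ_{xy}^k)`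
  (`ĥ_{xy} = hat (g_x g_y)`, `V_x = T_{g_x} Q_x` the one-sided convolution transform), and the assembly
  `ProdData.exists_polymathFunctional_gt_four`.
* Part C (kernel checker): a certificate `ProdCert` (profile magnitudes `a_{x,s}`, `g_x = Σ_s (-1)^s a_{x,s} 2^{-T} u^s`;
  integer radial coefficients `q_{x,i}`), a closed `ℕ/ℤ` program `ProdCert.check k en ed C : Bool`
  (structural recursions only: Kronecker pack `Σ_m H_m 2^{Bm}`, ONE `Nat.pow` per (pair, side), windowed shift/mask
  digits = coefficients of `ĥ^n` scaled, even/odd Horner passes giving `Λ_{n,c,ρ}` exactly, exact integer assembly of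
  `4·I·DenJ < (k+1)·J₁·DenI`), its soundness `ProdCert.sound`, and the TABULATED form `ProdCert.checkTab` /
  `ProdCert.sound_tab` (per-pair numerators supplied as tables and certified pair by pair, so that every kernel
  declaration stays small in time and memory).  A numerical instance is then a handful of `decide +kernel`
  declarations (axioms `propext`, `Classical.choice`, `Quot.sound` only).  Instances:
  `PolymathProdRadialCertL2.lean` (`k+1 = 52`), `PolymathProdRadialCertL3.lean` (`k+1 = 51`);
  deductions `liminf (p_{n+1}-p_n) ≤ 254, 252` in `PrimeGapsProdRadial.lean`.

## References
* D. H. J. Polymath, *Variants of the Selberg sieve, and bounded intervals containing many primes*,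
  Res. Math. Sci. 1 (2014), Art. 12; arXiv:1407.4897: Theorem 3.13, eq. (35), Lemma 4.4, Lemma 7.2, §7. [Polymath8b2014]
* J. von zur Gathen, J. Gerhard, *Modern Computer Algebra*, 3rd ed., CUP 2013, §8.4 (Kronecker substitution). [GathenGerhard2013ModernComputerAlgebra]
-/

open Polynomial MeasureTheory
open scoped BigOperators

namespace Literature.NumberTheory.Sieve.PolymathCert

/-- Product-radial certificate data: finitely many (profile `g_x`, radial polynomial `Q_x`) pairs.
[cite: Polymath8b2014, Lemma 7.2] -/
structure ProdData (ι : Type*) where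
  /-- degree bound of the radial polynomials -/
  A : ℕ
  /-- degree bound of the profiles -/
  S : ℕ
  /-- the one-variable profile `g_x` -/
  g : ι → ℝ[X]
  /-- the radial polynomial `Q_x`, contributing `Q_x(r - Σ t) · ∏ i, g_x(t_i)` -/
  Q : ι → ℝ[X]
  /-- `deg g_x ≤ S` -/
  degg : ∀ x, (g x).natDegree ≤ S
  /-- `deg Q_x ≤ A` -/
  degQ : ∀ x, (Q x).natDegree ≤ A

variable {ι : Type*} [Fintype ι]

/-- `Φ(t) = Σ_x Q_x(r - Σ_i t_i) · ∏_i g_x(t_i)`. [cite: Polymath8b2014, Lemma 7.2] -/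
noncomputable def ProdData.Phi (D : ProdData ι) (k : ℕ) (r : ℝ) (t : Fin k → ℝ) : ℝ :=
  ∑ x, (D.Q x).eval (r - ∑ i, t i) * ∏ i, (D.g x).eval (t i)

/-- `Φ` is continuous. [folklore] -/
private theorem ProdData.continuous_Phi (D : ProdData ι) (k : ℕ) (r : ℝ) : Continuous (D.Phi k r) := by
  unfold ProdData.Phi
  refine continuous_finsetSum _ fun x _ => Continuous.mul ?_ ?_
  · exact (Polynomial.continuous _).comp (continuous_const.sub (continuous_finsetSum _ fun i _ => continuous_apply i))
  · exact continuous_finsetProd _ fun i _ => (Polynomial.continuous _).comp (continuous_apply i)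

/-- Products of profile values merge: `(∏ g_x(t_i)) (∏ g_y(t_i)) = ∏ (g_x g_y)(t_i)`. [folklore] -/
private theorem prod_eval_mul_prod_eval {k : ℕ} (p q : ℝ[X]) (t : Fin k → ℝ) :
    (∏ i, p.eval (t i)) * ∏ i, q.eval (t i) = ∏ i, (p * q).eval (t i) := by
  rw [← Finset.prod_mul_distrib]
  simp only [Polynomial.eval_mul]

/-- B1 (I-side, Dirichlet product form): `I(1_{r•R_k} Φ) = Σ_{x,y} Σ_a (Q_x Q_y)_a · Λ_{k,a,r}(ĥ_{xy}^k)`,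
`ĥ_{xy} = hat (g_x g_y)`. [cite: Polymath8b2014, Lemma 7.2] -/
theorem ProdData.polymathI_cutoff_Phi (D : ProdData ι) (k : ℕ) {r : ℝ} (hr : 0 ≤ r) {B : ℕ}
    (hB : ∀ x y, (D.Q x * D.Q y).natDegree < B) :
    polymathI k (cutoff k r (D.Phi k r)) =
      ∑ x, ∑ y, ∑ a ∈ Finset.range B,
        (D.Q x * D.Q y).coeff a * simplexFunctional k a r (hat (D.g x * D.g y) ^ k) := by
  rw [polymathI_cutoff]
  have hexp : ∀ t : Fin k → ℝ, D.Phi k r t ^ 2 =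
      ∑ x, ∑ y, ∑ a ∈ Finset.range B, (D.Q x * D.Q y).coeff a *
        ((r - ∑ i, t i) ^ a * ∏ i, (D.g x * D.g y).eval (t i)) := by
    intro t
    rw [sq, ProdData.Phi, Finset.sum_mul_sum]
    refine Finset.sum_congr rfl fun x _ => Finset.sum_congr rfl fun y _ => ?_
    have h1 : (D.Q x).eval (r - ∑ i, t i) * (∏ i, (D.g x).eval (t i)) *
        ((D.Q y).eval (r - ∑ i, t i) * ∏ i, (D.g y).eval (t i)) =
        (D.Q x * D.Q y).eval (r - ∑ i, t i) * ∏ i, (D.g x * D.g y).eval (t i) := by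
      rw [Polynomial.eval_mul, ← prod_eval_mul_prod_eval]; ring
    rw [h1, Polynomial.eval_eq_sum_range' (hB x y), Finset.sum_mul]
    refine Finset.sum_congr rfl fun a _ => ?_
    ring
  simp_rw [hexp]
  have hint : ∀ x y a, IntegrableOn (fun t : Fin k → ℝ => (D.Q x * D.Q y).coeff a *
      ((r - ∑ i, t i) ^ a * ∏ i, (D.g x * D.g y).eval (t i))) (scaledSimplex k r) := by
    intro x y a
    exact (continuous_const.mul (continuous_prodForm k a (fun _ => D.g x * D.g y) r)).continuousOn.integrableOn_compact
      (isCompact_scaledSimplex k r)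
  rw [integral_finsetSum _ (fun x _ => integrable_finsetSum _ fun y _ => integrable_finsetSum _ fun a _ => hint x y a)]
  refine Finset.sum_congr rfl fun x _ => ?_
  rw [integral_finsetSum _ (fun y _ => integrable_finsetSum _ fun a _ => hint x y a)]
  refine Finset.sum_congr rfl fun y _ => ?_
  rw [integral_finsetSum _ (fun a _ => hint x y a)]
  refine Finset.sum_congr rfl fun a _ => ?_
  rw [integral_const_mul]
  congr 1
  rw [setIntegral_scaledSimplex_prodForm a k (fun _ => D.g x * D.g y) r hr]
  congr 1
  rw [Finset.prod_const, Finset.card_univ, Fintype.card_fin]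

/-- The one-sided convolution transform `(T_g Q)(R) = ∫₀ᴿ Q(R - v) g(v) dv`, coefficientwise:
`T_g Q = Σ_{a,s} Q_a g_s · a! s!/(a+s+1)! · X^(a+s+1)` (generalises the tree's `betaT`, which is `g = X^(2s)`).
[cite: Polymath8b2014, Section 7.2] -/
noncomputable def convT (A S : ℕ) (g Q : ℝ[X]) : ℝ[X] :=
  ∑ a ∈ Finset.range (A + 1), ∑ s ∈ Finset.range (S + 1),
    Polynomial.monomial (a + s + 1)
      (Q.coeff a * g.coeff s * ((a.factorial : ℝ) * (s.factorial : ℝ) / ((a + s + 1).factorial : ℝ)))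

/-- Beta integral for a general polynomial profile: `∫₀ᴿ Q(R - v) g(v) dv = (T_g Q)(R)`.
[cite: Polymath8b2014, Lemma 7.2] -/
theorem integral_eval_sub_mul_eval {A S : ℕ} {g Q : ℝ[X]} (hg : g.natDegree ≤ S) (hQ : Q.natDegree ≤ A) (R : ℝ) :
    ∫ v in (0 : ℝ)..R, Q.eval (R - v) * g.eval v = (convT A S g Q).eval R := by
  have hexp : ∀ v : ℝ, Q.eval (R - v) * g.eval v =
      ∑ a ∈ Finset.range (A + 1), ∑ s ∈ Finset.range (S + 1),
        Q.coeff a * g.coeff s * (v ^ s * (R - v) ^ a) := by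
    intro v
    rw [Polynomial.eval_eq_sum_range' (Nat.lt_succ_of_le hQ), Polynomial.eval_eq_sum_range' (Nat.lt_succ_of_le hg),
      Finset.sum_mul_sum]
    refine Finset.sum_congr rfl fun a _ => Finset.sum_congr rfl fun s _ => ?_
    ring
  simp_rw [hexp]
  rw [intervalIntegral.integral_finsetSum (fun a _ => ?_)]
  · rw [convT, Polynomial.eval_finsetSum]
    refine Finset.sum_congr rfl fun a _ => ?_
    rw [intervalIntegral.integral_finsetSum (fun s _ => ?_)]
    · rw [Polynomial.eval_finsetSum]
      refine Finset.sum_congr rfl fun s _ => ?_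
      rw [intervalIntegral.integral_const_mul, integral_pow_mul_sub_pow, Polynomial.eval_monomial]
      rw [show s + a + 1 = a + s + 1 by ring]
      ring
    · exact (Continuous.intervalIntegrable (by fun_prop) _ _)
  · exact Continuous.intervalIntegrable (continuous_finsetSum _ fun s _ => by fun_prop) _ _

/-- `ψ(t') = Σ_x (T_{g_x} Q_x)(r - Σ_j t'_j) · ∏_j g_x(t'_j)` — the inner integral of `F` over the dummy coordinate.
[cite: Polymath8b2014, Section 7.2] -/
noncomputable def ProdData.psi (D : ProdData ι) (k : ℕ) (r : ℝ) (t' : Fin k → ℝ) : ℝ :=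
  ∑ x, (convT D.A D.S (D.g x) (D.Q x)).eval (r - ∑ j, t' j) * ∏ j, (D.g x).eval (t' j)

/-- `ψ` is continuous. [folklore] -/
private theorem ProdData.continuous_psi (D : ProdData ι) (k : ℕ) (r : ℝ) : Continuous (D.psi k r) := by
  unfold ProdData.psi
  refine continuous_finsetSum _ fun x _ => Continuous.mul ?_ ?_
  · exact (Polynomial.continuous _).comp (continuous_const.sub (continuous_finsetSum _ fun i _ => continuous_apply i))
  · exact continuous_finsetProd _ fun i _ => (Polynomial.continuous _).comp (continuous_apply i)

/-- B2 (inner integral): for `t' ∈ r' • R_k`, `r' ≤ r`, `∫_{v>0} F(insertNth i v t') dv = ψ(t')`.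
[cite: Polymath8b2014, Section 7.2] -/
theorem ProdData.inner_integral (D : ProdData ι) (k : ℕ) (i : Fin (k + 1)) {r r' : ℝ} (hr : r' ≤ r)
    {t' : Fin k → ℝ} (ht' : t' ∈ scaledSimplex k r') :
    ∫ v in Set.Ioi (0 : ℝ), cutoff (k + 1) r (D.Phi (k + 1) r) (i.insertNth v t') = D.psi k r t' := by
  rw [integral_Ioi_cutoff_insertNth i hr _ ht']
  set R := r - ∑ j, t' j with hR
  have hexp : ∀ v : ℝ, D.Phi (k + 1) r (i.insertNth v t') =
      ∑ x, (D.Q x).eval (R - v) * (D.g x).eval v * ∏ j, (D.g x).eval (t' j) := by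
    intro v
    rw [ProdData.Phi]
    refine Finset.sum_congr rfl fun x _ => ?_
    rw [Fin.sum_univ_succAbove _ i, Fin.prod_univ_succAbove _ i]
    simp only [Fin.insertNth_apply_same, Fin.insertNth_apply_succAbove]
    rw [show r - (v + ∑ j, t' j) = R - v by rw [hR]; ring]
    ring
  simp_rw [hexp]
  rw [intervalIntegral.integral_finsetSum (fun x _ => ?_)]
  · rw [ProdData.psi]
    refine Finset.sum_congr rfl fun x _ => ?_
    rw [intervalIntegral.integral_mul_const, integral_eval_sub_mul_eval (D.degg x) (D.degQ x)]
  · exact Continuous.intervalIntegrable (by fun_prop) _ _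

/-- B3a: `J_{i,r'}(F) = ∫_{r'•R_k} ψ²`, the same for every `i`. [cite: Polymath8b2014, Section 7.2] -/
theorem ProdData.polymathJ_cutoff_Phi (D : ProdData ι) (k : ℕ) (i : Fin (k + 1)) {r r' : ℝ} (hr : r' ≤ r) :
    polymathJ (k + 1) r' i (cutoff (k + 1) r (D.Phi (k + 1) r)) = ∫ t' in scaledSimplex k r', D.psi k r t' ^ 2 :=
  polymathJ_eq_of_inner i r' _ (D.continuous_psi k r) fun _ ht' => D.inner_integral k i hr ht'

/-- The shifted coefficient `[x^c] U(d + x) = Σ_{N<B} U_N · C(N,c) · d^(N-c)` (binomial re-expansion,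
Polymath 8b §7.2 `(1+ε-P₁)^a = (2ε + (1-ε-P₁))^a`). [cite: Polymath8b2014, Section 7.2] -/
noncomputable def shiftCoeff (U : ℝ[X]) (B : ℕ) (d : ℝ) (c : ℕ) : ℝ :=
  ∑ N ∈ Finset.range B, U.coeff N * ((N.choose c : ℝ) * d ^ (N - c))

/-- `U(d + x) = Σ_{c<B} shiftCoeff_c · x^c` when `deg U < B`. [cite: Polymath8b2014, Section 7.2] -/
theorem eval_add_eq_sum_shiftCoeff (U : ℝ[X]) {B : ℕ} (hB : U.natDegree < B) (d x : ℝ) :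
    U.eval (d + x) = ∑ c ∈ Finset.range B, shiftCoeff U B d c * x ^ c := by
  rw [Polynomial.eval_eq_sum_range' hB]
  have h1 : ∀ N ∈ Finset.range B, U.coeff N * (d + x) ^ N =
      ∑ c ∈ Finset.range B, U.coeff N * ((N.choose c : ℝ) * d ^ (N - c)) * x ^ c := by
    intro N hN
    rw [add_comm d x, add_pow, Finset.mul_sum]
    rw [← Finset.sum_range_add_sum_Ico _ (show N + 1 ≤ B by simpa using hN)]
    rw [Finset.sum_eq_zero (s := Finset.Ico (N + 1) B) (fun c hc => by
      rw [Nat.choose_eq_zero_of_lt (by simpa using (Finset.mem_Ico.1 hc).1)]; simp), add_zero]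
    refine Finset.sum_congr rfl fun c _ => ?_
    ring
  rw [Finset.sum_congr rfl h1, Finset.sum_comm]
  refine Finset.sum_congr rfl fun c _ => ?_
  rw [shiftCoeff, Finset.sum_mul]

/-- Shifted Dirichlet product form: `∫_{ρ•R_k} U(d + (ρ - Σt)) ∏ h(t_i) dt = Σ_c shiftCoeff_c · Λ_{k,c,ρ}(ĥ^k)`.
[cite: Polymath8b2014, Lemma 7.2] -/
theorem setIntegral_scaledSimplex_evalShift_prodForm (k : ℕ) {ρ : ℝ} (hρ : 0 ≤ ρ) (d : ℝ)
    (U : ℝ[X]) {B : ℕ} (hB : U.natDegree < B) (h : ℝ[X]) :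
    ∫ t in scaledSimplex k ρ, U.eval (d + (ρ - ∑ i, t i)) * ∏ i, h.eval (t i) =
      ∑ c ∈ Finset.range B, shiftCoeff U B d c * simplexFunctional k c ρ (hat h ^ k) := by
  have hexp : ∀ t : Fin k → ℝ, U.eval (d + (ρ - ∑ i, t i)) * ∏ i, h.eval (t i) =
      ∑ c ∈ Finset.range B, shiftCoeff U B d c * ((ρ - ∑ i, t i) ^ c * ∏ i, h.eval (t i)) := by
    intro t
    rw [eval_add_eq_sum_shiftCoeff U hB, Finset.sum_mul]
    refine Finset.sum_congr rfl fun c _ => ?_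
    ring
  simp_rw [hexp]
  have hint : ∀ c, IntegrableOn (fun t : Fin k → ℝ =>
      shiftCoeff U B d c * ((ρ - ∑ i, t i) ^ c * ∏ i, h.eval (t i))) (scaledSimplex k ρ) := by
    intro c
    exact (continuous_const.mul (continuous_prodForm k c (fun _ => h) ρ)).continuousOn.integrableOn_compact
      (isCompact_scaledSimplex k ρ)
  rw [integral_finsetSum _ (fun c _ => hint c)]
  refine Finset.sum_congr rfl fun c _ => ?_
  rw [integral_const_mul]
  congr 1
  rw [setIntegral_scaledSimplex_prodForm c k (fun _ => h) ρ hρ]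
  congr 1
  rw [Finset.prod_const, Finset.card_univ, Fintype.card_fin]

/-- B3b (J-side, Dirichlet product form with the shift `d = r - r'`):
`∫_{r'•R_k} ψ² = Σ_{x,y} Σ_c shiftCoeff(V_x V_y, d)_c · Λ_{k,c,r'}(ĥ_{xy}^k)`, `V_x = T_{g_x} Q_x`.
[cite: Polymath8b2014, Section 7.2] -/
theorem ProdData.setIntegral_psi_sq (D : ProdData ι) (k : ℕ) {r r' : ℝ} (hr' : 0 ≤ r') {B : ℕ}
    (hB : ∀ x y, (convT D.A D.S (D.g x) (D.Q x) * convT D.A D.S (D.g y) (D.Q y)).natDegree < B) :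
    ∫ t' in scaledSimplex k r', D.psi k r t' ^ 2 =
      ∑ x, ∑ y, ∑ c ∈ Finset.range B,
        shiftCoeff (convT D.A D.S (D.g x) (D.Q x) * convT D.A D.S (D.g y) (D.Q y)) B (r - r') c *
          simplexFunctional k c r' (hat (D.g x * D.g y) ^ k) := by
  have hexp : ∀ t' : Fin k → ℝ, D.psi k r t' ^ 2 =
      ∑ x, ∑ y, (convT D.A D.S (D.g x) (D.Q x) * convT D.A D.S (D.g y) (D.Q y)).eval ((r - r') + (r' - ∑ j, t' j)) *
        ∏ j, (D.g x * D.g y).eval (t' j) := by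
    intro t'
    rw [sq, ProdData.psi, Finset.sum_mul_sum]
    refine Finset.sum_congr rfl fun x _ => Finset.sum_congr rfl fun y _ => ?_
    rw [Polynomial.eval_mul, show r - r' + (r' - ∑ j, t' j) = r - ∑ j, t' j by ring, ← prod_eval_mul_prod_eval]
    ring
  simp_rw [hexp]
  have hint : ∀ x y, IntegrableOn (fun t' : Fin k → ℝ =>
      (convT D.A D.S (D.g x) (D.Q x) * convT D.A D.S (D.g y) (D.Q y)).eval ((r - r') + (r' - ∑ j, t' j)) *
        ∏ j, (D.g x * D.g y).eval (t' j)) (scaledSimplex k r') := by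
    intro x y
    refine (Continuous.continuousOn ?_).integrableOn_compact (isCompact_scaledSimplex k r')
    refine Continuous.mul ((Polynomial.continuous _).comp (by fun_prop)) ?_
    exact continuous_finsetProd _ fun j _ => (Polynomial.continuous _).comp (continuous_apply j)
  rw [integral_finsetSum _ (fun x _ => integrable_finsetSum _ fun y _ => hint x y)]
  refine Finset.sum_congr rfl fun x _ => ?_
  rw [integral_finsetSum _ (fun y _ => hint x y)]
  refine Finset.sum_congr rfl fun y _ => ?_
  exact setIntegral_scaledSimplex_evalShift_prodForm k hr' (r - r') _ (hB x y) _

/-- B4 (assembly): a product-radial certificate for `M_{k+1,ε} > 4`.  The hypotheses are the two CLOSED FORMS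
(values `Ival`, `Jval` certified elsewhere) and the two inequalities `0 < I`, `4 I < (k+1) J`.
[cite: Polymath8b2014, Theorem 3.12] -/
theorem ProdData.exists_polymathFunctional_gt_four (D : ProdData ι) (k : ℕ) {ε : ℝ} (hε0 : 0 < ε) (hε1 : ε < 1)
    {BI BJ : ℕ} (hBI : ∀ x y, (D.Q x * D.Q y).natDegree < BI)
    (hBJ : ∀ x y, (convT D.A D.S (D.g x) (D.Q x) * convT D.A D.S (D.g y) (D.Q y)).natDegree < BJ)
    {Ival Jval : ℝ}
    (hI : ∑ x, ∑ y, ∑ a ∈ Finset.range BI,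
        (D.Q x * D.Q y).coeff a * simplexFunctional (k + 1) a (1 + ε) (hat (D.g x * D.g y) ^ (k + 1)) = Ival)
    (hJ : ∑ x, ∑ y, ∑ c ∈ Finset.range BJ,
        shiftCoeff (convT D.A D.S (D.g x) (D.Q x) * convT D.A D.S (D.g y) (D.Q y)) BJ (2 * ε) c *
          simplexFunctional k c (1 - ε) (hat (D.g x * D.g y) ^ k) = Jval)
    (hIpos : 0 < Ival) (hcert : 4 * Ival < (k + 1 : ℝ) * Jval) :
    ∃ F : (Fin (k + 1) → ℝ) → ℝ, IsPolymathTestFunction (k + 1) ε F ∧ 4 < polymathFunctional (k + 1) ε F := by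
  have hIeq : polymathI (k + 1) (cutoff (k + 1) (1 + ε) (D.Phi (k + 1) (1 + ε))) = Ival := by
    rw [D.polymathI_cutoff_Phi (k + 1) (by linarith) hBI, hI]
  have hJeq : ∀ i : Fin (k + 1),
      polymathJ (k + 1) (1 - ε) i (cutoff (k + 1) (1 + ε) (D.Phi (k + 1) (1 + ε))) = Jval := by
    intro i
    rw [D.polymathJ_cutoff_Phi k i (by linarith : 1 - ε ≤ 1 + ε),
      D.setIntegral_psi_sq k (by linarith : (0 : ℝ) ≤ 1 - ε) hBJ,
      show (1 + ε) - (1 - ε) = 2 * ε by ring, hJ]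
  have hIpos' : 0 < polymathI (k + 1) (cutoff (k + 1) (1 + ε) (D.Phi (k + 1) (1 + ε))) := by
    rw [hIeq]; exact hIpos
  refine ⟨_, isPolymathTestFunction_cutoff (D.continuous_Phi (k + 1) (1 + ε)) hIpos', ?_⟩
  have hsum : ∑ i : Fin (k + 1), polymathJ (k + 1) (1 - ε) i (cutoff (k + 1) (1 + ε) (D.Phi (k + 1) (1 + ε))) =
      (k + 1 : ℝ) * Jval := by
    rw [Finset.sum_congr rfl (fun i _ => hJeq i), Finset.sum_const, Finset.card_univ, Fintype.card_fin]
    simp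
  rw [polymathFunctional, hsum, hIeq, lt_div_iff₀ hIpos]
  linarith


/-! ## Part C — the kernel checker for product-radial certificates and its soundness

A certificate `C : ProdCert` stores, for `J = C.prof.length` product-radial terms, the profile magnitudes
`a_{x,s}` (`g_x = Σ_{s≤S} (-1)^s a_{x,s} 2^{-T} u^s`) and the integer radial coefficients `q_{x,i}`
(`Q_x = Σ_{i≤A} q_{x,i} X^i`).  `ProdCert.check k en ed C : Bool` is a closed ℕ/ℤ program (structural recursions,
one `Nat.pow` + shift/mask digits per (pair, side), Horner passes; no `Finset`/`Polynomial`/`ℝ`) deciding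
`4·I·DenJ < (k+1)·J₁num·DenI` for the test function `cutoff (k+1) (1+ε) Φ`, `ε = en/ed`; `ProdCert.sound` turns
`check … = true` into `∃ ε F, … 4 < polymathFunctional (k+1) ε F` via Part B. -/

section KernelProgram

/-- `Σ_{i<n} f i` by structural recursion (kernel-evaluable). [cite: Polymath8b2014, Theorem 3.13, eq. (35)] -/
def nsum (f : ℕ → ℕ) : ℕ → ℕ
  | 0 => 0
  | n + 1 => nsum f n + f n

/-- `Σ_{i<n} f i` over `ℤ` by structural recursion. [cite: Polymath8b2014, Theorem 3.13, eq. (35)] -/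
def zsum (f : ℕ → ℤ) : ℕ → ℤ
  | 0 => 0
  | n + 1 => zsum f n + f n

/-- `∀ i < n, p i` by structural recursion. [cite: Polymath8b2014, Theorem 3.13, eq. (35)] -/
def nall (p : ℕ → Bool) : ℕ → Bool
  | 0 => true
  | n + 1 => nall p n && p n

/-- `2^n` by shifting. [cite: Polymath8b2014, Theorem 3.13, eq. (35)] -/
def pow2 (n : ℕ) : ℕ := 1 <<< n

/-- digit `N` of `P` in base `2^B`, by shift and mask, read through the 32-digit window
`(P >>> 32B⌊N/32⌋) mod 2^(32B)` so that the kernel's cached intermediate values stay small (K4/K11).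
[cite: GathenGerhard2013ModernComputerAlgebra, Section 8.4] -/
def dg (B P N : ℕ) : ℕ :=
  (((P >>> (B * 32 * (N / 32))) &&& (pow2 (B * 32) - 1)) >>> (B * (N % 32))) &&& (pow2 B - 1)

/-- One Horner pass over digits `d N, …, d (N+fuel-1)` with state `(rp = rn^N, accE, accO)`:
`acc ← acc·rd·(N+c) + d_N·rn^N` into the even/odd accumulator according to the parity of `N`.
[cite: Polymath8b2014, Theorem 3.13, eq. (35)] -/
def horner (d : ℕ → ℕ) (rn rd c : ℕ) : ℕ → ℕ → ℕ → ℕ → ℕ → ℕ × ℕ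
  | 0, _, _, aE, aO => (aE, aO)
  | fuel + 1, N, rp, aE, aO =>
      horner d rn rd c fuel (N + 1) (rp * rn)
        (aE * (rd * (N + c)) + d N * rp * ((N + 1) % 2))
        (aO * (rd * (N + c)) + d N * rp * (N % 2))

/-- signed difference of a pair. [cite: Polymath8b2014, Theorem 3.13, eq. (35)] -/
def zdiff (p : ℕ × ℕ) : ℤ := (p.1 : ℤ) - (p.2 : ℤ)

/-- The signed Horner value `Z = Σ_{K<L} (-1)^K d_K rn^K ∏_{K<j<L} rd (j+c)`. [cite: Polymath8b2014, Theorem 3.13, eq. (35)] -/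
def Zval (d : ℕ → ℕ) (rn rd c L : ℕ) : ℤ := zdiff (horner d rn rd c L 0 1 0 0)

end KernelProgram

/-- A product-radial certificate: profile magnitudes `prof[x][s] = a_{x,s}` (`g_x = Σ_s (-1)^s a_{x,s} 2^{-T} u^s`,
`s ≤ S`), radial coefficients `rad[x][i] = q_{x,i}` (`Q_x = Σ_{i≤A} q_{x,i} X^i`), and the digit widths `BI`, `BJ`
of the Kronecker packs on the `I`- and `J`-side. [cite: Polymath8b2014, Theorem 3.13, eq. (35)] -/
structure ProdCert where
  /-- profile degree -/
  S : ℕ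
  /-- radial degree -/
  A : ℕ
  /-- dyadic scale of the profiles -/
  T : ℕ
  /-- digit width, `I`-side -/
  BI : ℕ
  /-- digit width, `J`-side -/
  BJ : ℕ
  /-- profile magnitudes -/
  prof : List (List ℕ)
  /-- radial coefficients -/
  rad : List (List ℤ)

namespace ProdCert

variable (C : ProdCert)

section Program

/-- number of product terms. [cite: Polymath8b2014, Theorem 3.13, eq. (35)] -/
def J : ℕ := C.prof.length
/-- `a_{x,s}` (zero beyond `S`). [cite: Polymath8b2014, Theorem 3.13, eq. (35)] -/
def a (x s : ℕ) : ℕ := if s ≤ C.S then (C.prof.getD x []).getD s 0 else 0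
/-- `q_{x,i}` (zero beyond `A`). [cite: Polymath8b2014, Theorem 3.13, eq. (35)] -/
def q (x i : ℕ) : ℤ := if i ≤ C.A then (C.rad.getD x []).getD i 0 else 0
/-- number of coefficients of `ĥ_{xy}`. [cite: Polymath8b2014, Theorem 3.13, eq. (35)] -/
def M : ℕ := 2 * C.S + 1
/-- `H_{xy,m} = m! Σ_{s≤m} a_{x,s} a_{y,m-s}` (`= 2^{2T} |ĥ_{xy,m}|`). [cite: Polymath8b2014, Lemma 4.4] -/
def Hc (x y m : ℕ) : ℕ := m.factorial * nsum (fun s => C.a x s * C.a y (m - s)) (m + 1)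
/-- `Σ_m H_{xy,m}` (digit bound base). [cite: Polymath8b2014, Lemma 4.4] -/
def Hsum (x y : ℕ) : ℕ := nsum (C.Hc x y) C.M
/-- Kronecker pack `Σ_m H_{xy,m} 2^{Bm}`. [cite: Polymath8b2014, Lemma 4.4] -/
def pack (B x y : ℕ) : ℕ := nsum (fun m => C.Hc x y m <<< (B * m)) C.M
/-- degree bound of `ĥ^n`. [cite: Polymath8b2014, Lemma 4.4] -/
def L (n : ℕ) : ℕ := n * (2 * C.S)
/-- `(Q_x Q_y)_t`. [cite: Polymath8b2014, Theorem 3.13, eq. (35)] -/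
def QQ (x y t : ℕ) : ℤ := zsum (fun i => C.q x i * C.q y (t - i)) (t + 1)
/-- integer Beta weight `u! s! (A+S+1)!/(u+s+1)!`. [cite: Polymath8b2014, Lemma 4.4] -/
def bw (u s : ℕ) : ℕ := u.factorial * s.factorial * ((C.A + C.S + 1).factorial / (u + s + 1).factorial)
/-- `2^T (A+S+1)! · [X^j] T_{g_x} Q_x`. [cite: Polymath8b2014, Lemma 4.4] -/
def Vint (x j : ℕ) : ℤ :=
  zsum (fun u => zsum (fun s =>
    if u + s + 1 = j then C.q x u * (-1) ^ s * (C.a x s : ℤ) * (C.bw u s : ℤ) else 0) (C.S + 1)) (C.A + 1)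
/-- degree bound of `V_x V_y`. [cite: Polymath8b2014, Lemma 4.4] -/
def Cmax : ℕ := 2 * (C.A + C.S + 1)
/-- `(V_x V_y)_N` scaled. [cite: Polymath8b2014, Lemma 4.4] -/
def VV (x y N : ℕ) : ℤ := zsum (fun j => C.Vint x j * C.Vint y (N - j)) (N + 1)
/-- scaled shifted coefficient `[(V_x V_y)(X + 2ε)]_c · DU · ed^Cmax`. [cite: Polymath8b2014, Lemma 4.4] -/
def Uint (en ed x y c : ℕ) : ℤ :=
  zsum (fun N => C.VV x y N * ((N.choose c * (2 * en) ^ (N - c) * ed ^ (C.Cmax - (N - c)) : ℕ) : ℤ))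
    (C.Cmax + 1)
/-- digits of `ĥ^{k+1}` (scaled), `I`-side. [cite: Polymath8b2014, Lemma 4.4] -/
def dI (k x y : ℕ) : ℕ → ℕ := dg C.BI (C.pack C.BI x y ^ (k + 1))
/-- digits of `ĥ^k` (scaled), `J`-side. [cite: Polymath8b2014, Lemma 4.4] -/
def dJ (k x y : ℕ) : ℕ → ℕ := dg C.BJ (C.pack C.BJ x y ^ k)
/-- `I`-numerator of the pair `(x,y)`. [cite: Polymath8b2014, Theorem 3.13, eq. (35)] -/
def InumPair (k en ed x y : ℕ) : ℤ :=
  zsum (fun t => C.QQ x y t * ((t.factorial * (ed + en) ^ (k + 1 + t) : ℕ) : ℤ) *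
    Zval (C.dI k x y) (ed + en) ed (k + 1 + t) (C.L (k + 1) + (2 * C.A - t) + 1)) (2 * C.A + 1)
/-- `J`-numerator of the pair `(x,y)`. [cite: Polymath8b2014, Theorem 3.13, eq. (35)] -/
def JnumPair (k en ed x y : ℕ) : ℤ :=
  zsum (fun c => C.Uint en ed x y c * ((c.factorial * (ed - en) ^ (k + c) : ℕ) : ℤ) *
    Zval (C.dJ k x y) (ed - en) ed (k + c) (C.L k + (C.Cmax - c) + 1)) (C.Cmax + 1)
/-- total `I`-numerator. [cite: Polymath8b2014, Theorem 3.13, eq. (35)] -/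
def Inum (k en ed : ℕ) : ℤ := zsum (fun x => zsum (fun y => C.InumPair k en ed x y) C.J) C.J
/-- total `J₁`-numerator. [cite: Polymath8b2014, Theorem 3.13, eq. (35)] -/
def Jnum (k en ed : ℕ) : ℤ := zsum (fun x => zsum (fun y => C.JnumPair k en ed x y) C.J) C.J
/-- `I`-denominator. [cite: Polymath8b2014, Theorem 3.13, eq. (35)] -/
def DenI (k ed : ℕ) : ℕ :=
  pow2 C.T ^ (2 * (k + 1)) * ed ^ (C.L (k + 1) + 2 * C.A + (k + 1)) * (C.L (k + 1) + 2 * C.A + (k + 1)).factorial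
/-- scale of `V_x V_y`. [cite: Polymath8b2014, Lemma 4.4] -/
def DU : ℕ := (C.A + C.S + 1).factorial ^ 2 * pow2 C.T ^ 2
/-- `J₁`-denominator. [cite: Polymath8b2014, Theorem 3.13, eq. (35)] -/
def DenJ (k ed : ℕ) : ℕ :=
  C.DU * ed ^ C.Cmax * pow2 C.T ^ (2 * k) * ed ^ (C.L k + C.Cmax + k) * (C.L k + C.Cmax + k).factorial
/-- no-carry condition for the Kronecker digits of every pair, both sides. [cite: Polymath8b2014, Lemma 4.4] -/
def noCarry (k : ℕ) : Bool :=
  nall (fun x => nall (fun y =>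
    Nat.blt (C.Hsum x y ^ (k + 1)) (pow2 C.BI) && Nat.blt (C.Hsum x y ^ k) (pow2 C.BJ)) C.J) C.J
/-- THE CHECKER: `0 < en < ed`, no carries, `0 < I`, and `4·I·DenJ < (k+1)·J₁·DenI`.
[cite: Polymath8b2014, Theorem 3.13, eq. (35)] -/
def check (k en ed : ℕ) (C : ProdCert) : Bool :=
  Nat.blt 0 en && Nat.blt en ed && C.noCarry k && decide (0 < C.Inum k en ed) &&
    decide (4 * C.Inum k en ed * (C.DenJ k ed : ℤ) < ((k + 1 : ℕ) : ℤ) * C.Jnum k en ed * (C.DenI k ed : ℤ))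

/-- structural bounded conjunction `P 0 ∧ … ∧ P (n-1)` (left-nested, `True`-based). [folklore] -/
def pall (P : ℕ → Prop) : ℕ → Prop
  | 0 => True
  | n + 1 => pall P n ∧ P n

/-- THE CHECKER, TABULATED FORM (K4: one kernel declaration per pair and side): `check` with the per-pair
numerators `InumPair`, `JnumPair` read from tables `tI`, `tJ`. [cite: Polymath8b2014, Theorem 3.13, eq. (35)] -/
def checkTab (k en ed : ℕ) (C : ProdCert) (tI tJ : ℕ → ℕ → ℤ) : Bool :=
  Nat.blt 0 en && Nat.blt en ed && C.noCarry k &&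
    decide (0 < zsum (fun x => zsum (fun y => tI x y) C.J) C.J) &&
    decide (4 * zsum (fun x => zsum (fun y => tI x y) C.J) C.J * (C.DenJ k ed : ℤ) <
      ((k + 1 : ℕ) : ℤ) * zsum (fun x => zsum (fun y => tJ x y) C.J) C.J * (C.DenI k ed : ℤ))

end Program

/-! ### Specifications of the program pieces -/
section Spec

/-- the structural sum is the `Finset.range` sum. [cite: Polymath8b2014, Theorem 3.13, eq. (35)] -/
theorem nsum_eq (f : ℕ → ℕ) (n : ℕ) : nsum f n = ∑ i ∈ Finset.range n, f i := by
  induction n with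
  | zero => simp [nsum]
  | succ n ih => rw [nsum, ih, Finset.sum_range_succ]

/-- the structural `ℤ`-sum is the `Finset.range` sum. [cite: Polymath8b2014, Theorem 3.13, eq. (35)] -/
theorem zsum_eq (f : ℕ → ℤ) (n : ℕ) : zsum f n = ∑ i ∈ Finset.range n, f i := by
  induction n with
  | zero => simp [zsum]
  | succ n ih => rw [zsum, ih, Finset.sum_range_succ]

/-- the structural conjunction is the bounded universal. [cite: Polymath8b2014, Theorem 3.13, eq. (35)] -/
theorem nall_iff (p : ℕ → Bool) (n : ℕ) : nall p n = true ↔ ∀ i < n, p i = true := by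
  induction n with
  | zero => simp [nall]
  | succ n ih =>
    rw [nall, Bool.and_eq_true, ih]
    constructor
    · rintro ⟨h1, h2⟩ i hi
      rcases Nat.lt_succ_iff_lt_or_eq.1 hi with h | rfl
      · exact h1 i h
      · exact h2
    · intro h
      exact ⟨fun i hi => h i (Nat.lt_succ_of_lt hi), h n (Nat.lt_succ_self n)⟩

/-- `pall P n ↔ ∀ i < n, P i`. [cite: Polymath8b2014, §7 (finitely many test-function pairs, verified pair by pair)] -/
theorem pall_iff (P : ℕ → Prop) (n : ℕ) : pall P n ↔ ∀ i < n, P i := by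
  induction n with
  | zero => simp [pall]
  | succ n ih =>
    rw [pall, ih]
    constructor
    · rintro ⟨h, hn⟩ i hi
      rcases Nat.lt_succ_iff_lt_or_eq.1 hi with hi | rfl
      exacts [h i hi, hn]
    · exact fun h => ⟨fun i hi => h i (Nat.lt_succ_of_lt hi), h n (Nat.lt_succ_self n)⟩

/-- `pall P 0`. [cite: Polymath8b2014, §7 (finitely many test-function pairs, verified pair by pair)] -/
theorem pall_zero (P : ℕ → Prop) : pall P 0 := trivial

/-- `pall P n → P n → pall P (n+1)`. [cite: Polymath8b2014, §7 (finitely many test-function pairs, verified pair by pair)] -/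
theorem pall_succ {P : ℕ → Prop} {n : ℕ} (h : pall P n) (hn : P n) : pall P (n + 1) := ⟨h, hn⟩

/-- `checkTab` with correct tables implies `check`. [cite: Polymath8b2014, Theorem 3.13, eq. (35)] -/
theorem check_of_checkTab (k en ed J₀ : ℕ) (C : ProdCert) (tI tJ : ℕ → ℕ → ℤ) (hJ : C.J = J₀)
    (hP : pall (fun x => pall (fun y => C.InumPair k en ed x y = tI x y ∧ C.JnumPair k en ed x y = tJ x y) J₀) J₀)
    (h : checkTab k en ed C tI tJ = true) : check k en ed C = true := by
  subst hJ
  rw [pall_iff] at hP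
  have hP' : ∀ x < C.J, ∀ y < C.J, C.InumPair k en ed x y = tI x y ∧ C.JnumPair k en ed x y = tJ x y :=
    fun x hx => (pall_iff _ _).1 (hP x hx)
  have eI : C.Inum k en ed = zsum (fun x => zsum (fun y => tI x y) C.J) C.J := by
    simp only [Inum, zsum_eq]
    exact Finset.sum_congr rfl fun x hx => Finset.sum_congr rfl fun y hy =>
      (hP' x (Finset.mem_range.1 hx) y (Finset.mem_range.1 hy)).1
  have eJ : C.Jnum k en ed = zsum (fun x => zsum (fun y => tJ x y) C.J) C.J := by
    simp only [Jnum, zsum_eq]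
    exact Finset.sum_congr rfl fun x hx => Finset.sum_congr rfl fun y hy =>
      (hP' x (Finset.mem_range.1 hx) y (Finset.mem_range.1 hy)).2
  unfold check; rw [eI, eJ]; exact h

/-- `pow2 n = 2^n`. [cite: Polymath8b2014, Theorem 3.13, eq. (35)] -/
theorem pow2_eq (n : ℕ) : pow2 n = 2 ^ n := by rw [pow2, Nat.one_shiftLeft]

/-- the windowed shift/mask digits are the tree's `kdigit`. [cite: GathenGerhard2013ModernComputerAlgebra, Section 8.4] -/
theorem dg_eq_kdigit (B P N : ℕ) : dg B P N = Literature.Analysis.Convolution.kdigit B P N := by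
  simp only [dg, Literature.Analysis.Convolution.kdigit, Nat.shiftRight_eq_div_pow, pow2_eq,
    Nat.and_two_pow_sub_one_eq_mod]
  have h32 : N % 32 < 32 := Nat.mod_lt N (by norm_num)
  have hr : B * (N % 32) + B * (32 - N % 32) = B * 32 := by
    rw [← Nat.mul_add]; congr 1; omega
  have hdvd : 2 ^ B ∣ 2 ^ (B * (32 - N % 32)) :=
    pow_dvd_pow 2 (by calc B = B * 1 := (Nat.mul_one B).symm
      _ ≤ B * (32 - N % 32) := Nat.mul_le_mul_left B (by omega))
  rw [show (2 : ℕ) ^ (B * 32) = 2 ^ (B * (N % 32)) * 2 ^ (B * (32 - N % 32)) by rw [← pow_add, hr],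
    Nat.mod_mul_right_div_self, Nat.div_div_eq_div_mul, ← pow_add,
    show B * 32 * (N / 32) + B * (N % 32) = B * N by rw [Nat.mul_assoc, ← Nat.mul_add, Nat.div_add_mod],
    Nat.mod_mod_of_dvd _ hdvd]

/-- parity bookkeeping of the two accumulators. [folklore] -/
private theorem parity_cast (N : ℕ) : (((N + 1) % 2 : ℕ) : ℤ) - ((N % 2 : ℕ) : ℤ) = (-1) ^ N := by
  induction N with
  | zero => norm_num
  | succ n ih =>
    rw [pow_succ, show n + 1 + 1 = n + 2 by ring, Nat.add_mod_right]
    linear_combination (-1 : ℤ) * ih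

/-- The Horner invariant. [folklore] -/
private theorem horner_inv (d : ℕ → ℕ) (rn rd c : ℕ) :
    ∀ fuel N aE aO : ℕ,
      zdiff (horner d rn rd c fuel N (rn ^ N) aE aO) =
        ((aE : ℤ) - aO) * ∏ j ∈ Finset.Ico N (N + fuel), ((rd : ℤ) * (j + c)) +
          ∑ K ∈ Finset.Ico N (N + fuel), (-1) ^ K * (d K : ℤ) * (rn : ℤ) ^ K *
            ∏ j ∈ Finset.Ico (K + 1) (N + fuel), ((rd : ℤ) * (j + c)) := by
  intro fuel
  induction fuel with
  | zero => intro N aE aO; simp [horner, zdiff]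
  | succ fuel ih =>
    intro N aE aO
    simp only [horner]
    rw [← pow_succ, ih (N + 1), show N + (fuel + 1) = N + 1 + fuel by ring,
      Finset.prod_eq_prod_Ico_succ_bot (show N < N + 1 + fuel by omega),
      Finset.sum_eq_sum_Ico_succ_bot (show N < N + 1 + fuel by omega)]
    have hpar := parity_cast N
    simp only [Nat.cast_add, Nat.cast_mul, Nat.cast_pow]
    linear_combination ((d N : ℤ) * (rn : ℤ) ^ N *
      ∏ j ∈ Finset.Ico (N + 1) (N + 1 + fuel), ((rd : ℤ) * (j + c))) * hpar

/-- closed form of the signed Horner value. [folklore] -/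
private theorem Zval_eq (d : ℕ → ℕ) (rn rd c Lf : ℕ) :
    Zval d rn rd c Lf = ∑ K ∈ Finset.range Lf, (-1) ^ K * (d K : ℤ) * (rn : ℤ) ^ K *
      ∏ j ∈ Finset.Ico (K + 1) Lf, ((rd : ℤ) * (j + c)) := by
  have h := horner_inv d rn rd c Lf 0 0 0
  rw [pow_zero, zero_add] at h
  rw [Zval, h, Finset.range_eq_Ico]
  simp

/-- the factorial telescoping `∏_{K<j≤L'} (j+c) · (K+c)! = (L'+c)!`. [folklore] -/
private theorem prod_Ico_mul_factorial (c K : ℕ) : ∀ L', K ≤ L' →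
    (∏ j ∈ Finset.Ico (K + 1) (L' + 1), (j + c)) * (K + c).factorial = (L' + c).factorial := by
  intro L'
  induction L' with
  | zero =>
    intro h
    obtain rfl : K = 0 := by omega
    simp
  | succ L ih =>
    intro h
    rcases Nat.eq_or_lt_of_le h with rfl | hlt
    · simp
    · rw [Finset.prod_Ico_succ_top (by omega : K + 1 ≤ L + 1), mul_right_comm, ih (by omega),
        show L + 1 + c = (L + c) + 1 by ring, Nat.factorial_succ]
      ring

/-- real form of the Horner products. [folklore] -/
private theorem prod_Ico_real (rd c K L' : ℕ) (hK : K ≤ L') :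
    ∏ j ∈ Finset.Ico (K + 1) (L' + 1), ((rd : ℝ) * ((j : ℝ) + c)) =
      (rd : ℝ) ^ (L' - K) * ((L' + c).factorial : ℝ) / ((K + c).factorial : ℝ) := by
  rw [Finset.prod_mul_distrib, Finset.prod_const, Nat.card_Ico, show L' + 1 - (K + 1) = L' - K by omega,
    eq_div_iff (by positivity)]
  have h := prod_Ico_mul_factorial c K L' hK
  have h' : (∏ j ∈ Finset.Ico (K + 1) (L' + 1), ((j : ℝ) + c)) * ((K + c).factorial : ℝ) =
      ((L' + c).factorial : ℝ) := by exact_mod_cast h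
  rw [mul_assoc, h']

/-- the signed Horner value, real form. [folklore] -/
private theorem Zval_real (d : ℕ → ℕ) (rn rd c Lf : ℕ) :
    (Zval d rn rd c Lf : ℝ) = ∑ K ∈ Finset.range Lf, (-1) ^ K * (d K : ℝ) * (rn : ℝ) ^ K *
      ∏ j ∈ Finset.Ico (K + 1) Lf, ((rd : ℝ) * ((j : ℝ) + c)) := by
  rw [Zval_eq]; push_cast; rfl

/-! #### Polynomial identities -/

/-- Internal arithmetic of the certificate checker (`a_eq_zero`). [folklore] -/
private theorem a_eq_zero {x s : ℕ} (h : C.S < s) : C.a x s = 0 := by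
  rw [a, if_neg (by omega)]

/-- `q_{x,i} = 0` beyond `A`. [cite: Polymath8b2014, Theorem 3.13, eq. (35)] -/
theorem q_eq_zero {x i : ℕ} (h : C.A < i) : C.q x i = 0 := by
  rw [q, if_neg (by omega)]

/-- the profile magnitudes as an `ℕ`-polynomial. [cite: Polymath8b2014, Lemma 4.4] -/
noncomputable def aPoly (x : ℕ) : ℕ[X] := ∑ s ∈ Finset.range (C.S + 1), Polynomial.monomial s (C.a x s)
/-- the profile `g_x = Σ_s (-1)^s a_{x,s} 2^{-T} u^s`. [cite: Polymath8b2014, Lemma 4.4] -/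
noncomputable def gR (x : ℕ) : ℝ[X] :=
  ∑ s ∈ Finset.range (C.S + 1), Polynomial.monomial s ((1 / 2 ^ C.T : ℝ) * (-1) ^ s * (C.a x s : ℝ))
/-- the radial polynomial `Q_x`. [cite: Polymath8b2014, Theorem 3.13, eq. (35)] -/
noncomputable def QR (x : ℕ) : ℝ[X] :=
  ∑ i ∈ Finset.range (C.A + 1), Polynomial.monomial i ((C.q x i : ℤ) : ℝ)
/-- `HN_{xy} = Σ_m H_{xy,m} X^m : ℕ[X]`. [cite: Polymath8b2014, Lemma 4.4] -/
noncomputable def HN (x y : ℕ) : ℕ[X] := ∑ m ∈ Finset.range C.M, Polynomial.monomial m (C.Hc x y m)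

/-- coefficients of `aPoly`. [cite: Polymath8b2014, Theorem 3.13, eq. (35)] -/
theorem coeff_aPoly (x m : ℕ) : (C.aPoly x).coeff m = C.a x m := by
  rw [aPoly, Polynomial.finsetSum_coeff]
  simp only [Polynomial.coeff_monomial, Finset.sum_ite_eq', Finset.mem_range]
  split_ifs with h
  · rfl
  · exact (C.a_eq_zero (by omega)).symm

/-- coefficients of the profile `g_x`: `2^{-T} (-1)^m a_{x,m}`. [cite: Polymath8b2014, Theorem 3.13, eq. (35)] -/
theorem coeff_gR (x m : ℕ) :
    (C.gR x).coeff m = (1 / 2 ^ C.T : ℝ) * (-1) ^ m * ((C.aPoly x).coeff m : ℝ) := by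
  rw [coeff_aPoly, gR, Polynomial.finsetSum_coeff]
  simp only [Polynomial.coeff_monomial, Finset.sum_ite_eq', Finset.mem_range]
  split_ifs with h
  · rfl
  · rw [C.a_eq_zero (by omega)]; simp

/-- coefficients of `Q_x`. [cite: Polymath8b2014, Theorem 3.13, eq. (35)] -/
theorem coeff_QR (x m : ℕ) : (C.QR x).coeff m = ((C.q x m : ℤ) : ℝ) := by
  rw [QR, Polynomial.finsetSum_coeff]
  simp only [Polynomial.coeff_monomial, Finset.sum_ite_eq', Finset.mem_range]
  split_ifs with h
  · rfl
  · rw [C.q_eq_zero (by omega)]; simp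

/-- coefficients of `HN_{xy}`. [cite: Polymath8b2014, Theorem 3.13, eq. (35)] -/
theorem coeff_HN (x y m : ℕ) : (C.HN x y).coeff m = if m < C.M then C.Hc x y m else 0 := by
  rw [HN, Polynomial.finsetSum_coeff]
  simp only [Polynomial.coeff_monomial, Finset.sum_ite_eq', Finset.mem_range]

/-- `deg g_x ≤ S`. [cite: Polymath8b2014, Theorem 3.13, eq. (35)] -/
theorem natDegree_gR_le (x : ℕ) : (C.gR x).natDegree ≤ C.S :=
  Polynomial.natDegree_sum_le_of_forall_le _ _ fun _ hs =>
    (Polynomial.natDegree_monomial_le _).trans (Nat.lt_succ_iff.1 (Finset.mem_range.1 hs))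

/-- `deg Q_x ≤ A`. [cite: Polymath8b2014, Theorem 3.13, eq. (35)] -/
theorem natDegree_QR_le (x : ℕ) : (C.QR x).natDegree ≤ C.A :=
  Polynomial.natDegree_sum_le_of_forall_le _ _ fun _ hs =>
    (Polynomial.natDegree_monomial_le _).trans (Nat.lt_succ_iff.1 (Finset.mem_range.1 hs))

/-- `deg aPoly_x ≤ S`. [cite: Polymath8b2014, Theorem 3.13, eq. (35)] -/
theorem natDegree_aPoly_le (x : ℕ) : (C.aPoly x).natDegree ≤ C.S :=
  Polynomial.natDegree_sum_le_of_forall_le _ _ fun _ hs =>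
    (Polynomial.natDegree_monomial_le _).trans (Nat.lt_succ_iff.1 (Finset.mem_range.1 hs))

/-- `deg HN_{xy} ≤ 2S`. [cite: Polymath8b2014, Theorem 3.13, eq. (35)] -/
theorem natDegree_HN_le (x y : ℕ) : (C.HN x y).natDegree ≤ 2 * C.S :=
  Polynomial.natDegree_sum_le_of_forall_le _ _ fun _ hs =>
    (Polynomial.natDegree_monomial_le _).trans (by have := Finset.mem_range.1 hs; rw [M] at this; omega)

/-- products of alternating-sign polynomials. [folklore] -/
private theorem coeff_mul_alt {p r : ℝ[X]} {P R : ℕ[X]} {cp cr : ℝ}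
    (hp : ∀ m, p.coeff m = cp * (-1) ^ m * (P.coeff m : ℝ))
    (hr : ∀ m, r.coeff m = cr * (-1) ^ m * (R.coeff m : ℝ)) (m : ℕ) :
    (p * r).coeff m = (cp * cr) * (-1) ^ m * ((P * R).coeff m : ℝ) := by
  rw [Polynomial.coeff_mul, Polynomial.coeff_mul, Nat.cast_sum, Finset.mul_sum]
  refine Finset.sum_congr rfl fun z hz => ?_
  rw [hp, hr, ← Finset.HasAntidiagonal.mem_antidiagonal.1 hz, pow_add, Nat.cast_mul]
  ring

/-- powers of alternating-sign polynomials. [folklore] -/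
private theorem coeff_pow_alt {p : ℝ[X]} {P : ℕ[X]} {cp : ℝ}
    (hp : ∀ m, p.coeff m = cp * (-1) ^ m * (P.coeff m : ℝ)) :
    ∀ n m, (p ^ n).coeff m = cp ^ n * (-1) ^ m * ((P ^ n).coeff m : ℝ) := by
  intro n
  induction n with
  | zero =>
    intro m
    simp only [pow_zero, Polynomial.coeff_one]
    split_ifs with h
    · subst h; simp
    · simp
  | succ n ih =>
    intro m
    rw [pow_succ, pow_succ, coeff_mul_alt ih hp, ← pow_succ, ← pow_succ]

/-- `H_{xy,m} = m! (aPoly_x aPoly_y)_m`. [cite: Polymath8b2014, Theorem 3.13, eq. (35)] -/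
theorem Hc_eq (x y m : ℕ) : C.Hc x y m = m.factorial * (C.aPoly x * C.aPoly y).coeff m := by
  rw [Hc, nsum_eq, Polynomial.coeff_mul, Finset.Nat.sum_antidiagonal_eq_sum_range_succ_mk]
  simp only [coeff_aPoly]

/-- `(HN_{xy})_m = m! (aPoly_x aPoly_y)_m` for all `m`. [cite: Polymath8b2014, Theorem 3.13, eq. (35)] -/
theorem coeff_HN_eq (x y m : ℕ) : (C.HN x y).coeff m = m.factorial * (C.aPoly x * C.aPoly y).coeff m := by
  rw [coeff_HN]
  split_ifs with h
  · exact C.Hc_eq x y m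
  · rw [Polynomial.coeff_eq_zero_of_natDegree_lt (p := C.aPoly x * C.aPoly y)]
    · simp
    · refine lt_of_le_of_lt Polynomial.natDegree_mul_le ?_
      have := C.natDegree_aPoly_le x; have := C.natDegree_aPoly_le y; rw [M] at h; omega

/-- the scaled-`ℕ` description of `ĥ_{xy} = hat (g_x g_y)`: coefficient `m` is `2^{-2T} (-1)^m H_{xy,m}`. [folklore] -/
private theorem coeff_hat_gg (x y m : ℕ) :
    (hat (C.gR x * C.gR y)).coeff m = (1 / (2 ^ C.T) ^ 2 : ℝ) * (-1) ^ m * ((C.HN x y).coeff m : ℝ) := by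
  rw [coeff_hat, coeff_mul_alt (C.coeff_gR x) (C.coeff_gR y), coeff_HN_eq, Nat.cast_mul]
  have h2 : (2 : ℝ) ^ C.T ≠ 0 := by positivity
  field_simp

/-- coefficients of `ĥ_{xy}^n`: `2^{-2Tn} (-1)^K (HN_{xy}^n)_K`. [cite: Polymath8b2014, Theorem 3.13, eq. (35)] -/
theorem coeff_hat_gg_pow (x y n K : ℕ) :
    (hat (C.gR x * C.gR y) ^ n).coeff K =
      (1 / (2 ^ C.T) ^ 2 : ℝ) ^ n * (-1) ^ K * ((C.HN x y ^ n).coeff K : ℝ) :=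
  coeff_pow_alt (C.coeff_hat_gg x y) n K

/-- `deg HN^n ≤ n·2S`. [cite: Polymath8b2014, Theorem 3.13, eq. (35)] -/
theorem natDegree_HN_pow_le (x y n : ℕ) : (C.HN x y ^ n).natDegree ≤ C.L n :=
  Polynomial.natDegree_pow_le.trans (by rw [L]; exact Nat.mul_le_mul_left n (C.natDegree_HN_le x y))

/-- `deg ĥ^n < n·2S + e + 1`. [cite: Polymath8b2014, Theorem 3.13, eq. (35)] -/
theorem natDegree_hat_gg_pow_lt (x y n e : ℕ) : (hat (C.gR x * C.gR y) ^ n).natDegree < C.L n + e + 1 := by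
  refine Nat.lt_succ_of_le ((Polynomial.natDegree_le_iff_coeff_eq_zero.2 fun K hK => ?_).trans
    (Nat.le_add_right _ _))
  rw [coeff_hat_gg_pow, Polynomial.coeff_eq_zero_of_natDegree_lt ((C.natDegree_HN_pow_le x y n).trans_lt hK)]
  simp

/-! #### Kronecker digits -/

/-- Internal arithmetic of the certificate checker (`pack_eq_eval`). [folklore] -/
private theorem pack_eq_eval (B x y : ℕ) : C.pack B x y = (C.HN x y).eval (2 ^ B) := by
  rw [pack, nsum_eq, HN, Polynomial.eval_finsetSum]
  refine Finset.sum_congr rfl fun m _ => ?_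
  rw [Polynomial.eval_monomial, Nat.shiftLeft_eq, pow_mul]

/-- `Σ_m H_m = HN(1)`. [cite: Polymath8b2014, Theorem 3.13, eq. (35)] -/
theorem Hsum_eq_eval (x y : ℕ) : C.Hsum x y = (C.HN x y).eval 1 := by
  rw [Hsum, nsum_eq, HN, Polynomial.eval_finsetSum]
  refine Finset.sum_congr rfl fun m _ => ?_
  rw [Polynomial.eval_monomial, one_pow, mul_one]

/-- a coefficient of an `ℕ`-polynomial is at most its value at `1`. [cite: Polymath8b2014, Theorem 3.13, eq. (35)] -/
theorem coeff_le_eval_one (P : ℕ[X]) (K : ℕ) : P.coeff K ≤ P.eval 1 := by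
  rw [Polynomial.eval_eq_sum_range]
  simp only [one_pow, mul_one]
  by_cases h : K < P.natDegree + 1
  · exact Finset.single_le_sum (fun i _ => Nat.zero_le (P.coeff i)) (Finset.mem_range.2 h)
  · rw [Polynomial.coeff_eq_zero_of_natDegree_lt (by omega)]; exact Nat.zero_le _

/-- under the no-carry bound the shift/mask digits of `pack^n` ARE the coefficients of `HN^n`. [folklore] -/
private theorem dg_pack_pow (B x y n : ℕ) (hB : C.Hsum x y ^ n < 2 ^ B) (K : ℕ) :
    dg B (C.pack B x y ^ n) K = (C.HN x y ^ n).coeff K := by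
  have hco : ∀ j, (C.HN x y ^ n).coeff j < 2 ^ B := fun j =>
    (coeff_le_eval_one _ j).trans_lt (by rwa [Polynomial.eval_pow, ← Hsum_eq_eval])
  have hpk : C.pack B x y ^ n =
      Literature.Analysis.Convolution.kpack B (C.L n + 1) fun j => (C.HN x y ^ n).coeff j := by
    rw [pack_eq_eval, ← Polynomial.eval_pow,
      Polynomial.eval_eq_sum_range' (Nat.lt_succ_of_le (C.natDegree_HN_pow_le x y n)),
      Literature.Analysis.Convolution.kpack]
    refine Finset.sum_congr rfl fun j _ => ?_
    rw [pow_mul]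
  rw [dg_eq_kdigit, hpk, Literature.Analysis.Convolution.kdigit_kpack (fun j _ => hco j)]
  split_ifs with h
  · rfl
  · exact (Polynomial.coeff_eq_zero_of_natDegree_lt ((C.natDegree_HN_pow_le x y n).trans_lt (by omega))).symm

/-! #### The simplex functional from the Horner value -/

/-- `Λ_{n,c,rn/rd}(ĥ_{xy}^n)` from the signed Horner value of the digits (any number `e` of extra zero-digit steps).
[cite: Polymath8b2014, Lemma 4.4] -/
theorem simplexFunctional_eq_Zval (x y n c e rn rd B : ℕ) (hrd : 0 < rd) (hB : C.Hsum x y ^ n < 2 ^ B) :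
    simplexFunctional n c ((rn : ℝ) / rd) (hat (C.gR x * C.gR y) ^ n) =
      (c.factorial : ℝ) * ((rn : ℝ) / rd) ^ (n + c) * (1 / (2 ^ C.T) ^ 2 : ℝ) ^ n *
        (Zval (dg B (C.pack B x y ^ n)) rn rd (n + c) (C.L n + e + 1) : ℝ) /
          ((rd : ℝ) ^ (C.L n + e) * ((C.L n + e + (n + c)).factorial : ℝ)) := by
  have hrd' : (rd : ℝ) ≠ 0 := by positivity
  rw [simplexFunctional_eq_sum_range n c _ _ (C.natDegree_hat_gg_pow_lt x y n e), Zval_real,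
    Finset.mul_sum, Finset.sum_div]
  refine Finset.sum_congr rfl fun K hK => ?_
  have hKL : K ≤ C.L n + e := Nat.lt_succ_iff.1 (Finset.mem_range.1 hK)
  rw [coeff_hat_gg_pow, dg_pack_pow C B x y n hB, simplexWeight, prod_Ico_real rd (n + c) K (C.L n + e) hKL]
  have hpow : (rd : ℝ) ^ (C.L n + e) = (rd : ℝ) ^ K * (rd : ℝ) ^ (C.L n + e - K) := by
    rw [← pow_add, Nat.add_sub_cancel' hKL]
  rw [hpow, show K + n + c = K + (n + c) by ring, div_pow, pow_add ((rn : ℝ) / rd) K (n + c), div_pow]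
  have h2 : (2 : ℝ) ^ C.T ≠ 0 := by positivity
  have hf1 : ((K + (n + c)).factorial : ℝ) ≠ 0 := by positivity
  have hf2 : ((C.L n + e + (n + c)).factorial : ℝ) ≠ 0 := by positivity
  field_simp

/-! #### The `I`-side per pair -/

/-- Internal arithmetic of the certificate checker (`coeff_QR_mul`). [folklore] -/
private theorem coeff_QR_mul (x y t : ℕ) : (C.QR x * C.QR y).coeff t = ((C.QQ x y t : ℤ) : ℝ) := by
  rw [Polynomial.coeff_mul, Finset.Nat.sum_antidiagonal_eq_sum_range_succ_mk, QQ, zsum_eq, Int.cast_sum]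
  refine Finset.sum_congr rfl fun i _ => ?_
  rw [coeff_QR, coeff_QR, Int.cast_mul]

/-- `deg (Q_xQ_y) < 2A+1`. [cite: Polymath8b2014, Theorem 3.13, eq. (35)] -/
theorem natDegree_QR_mul_lt (x y : ℕ) : (C.QR x * C.QR y).natDegree < 2 * C.A + 1 :=
  Nat.lt_succ_of_le (Polynomial.natDegree_mul_le.trans
    (by have := C.natDegree_QR_le x; have := C.natDegree_QR_le y; omega))

/-- `Σ_t (Q_xQ_y)_t Λ_{k+1,t,(ed+en)/ed}(ĥ^{k+1}) = InumPair · 2^{-2T(k+1)} / (ed^{L+2A+k+1} (L+2A+k+1)!)`.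
[cite: Polymath8b2014, Theorem 3.13, eq. (35)] -/
theorem Ipair_eq (k en ed x y : ℕ) (hed : 0 < ed) (hB : C.Hsum x y ^ (k + 1) < 2 ^ C.BI) :
    ∑ t ∈ Finset.range (2 * C.A + 1), (C.QR x * C.QR y).coeff t *
        simplexFunctional (k + 1) t (((ed + en : ℕ) : ℝ) / ed) (hat (C.gR x * C.gR y) ^ (k + 1)) =
      ((C.InumPair k en ed x y : ℤ) : ℝ) * (1 / (2 ^ C.T) ^ 2 : ℝ) ^ (k + 1) /
        ((ed : ℝ) ^ (C.L (k + 1) + 2 * C.A + (k + 1)) * ((C.L (k + 1) + 2 * C.A + (k + 1)).factorial : ℝ)) := by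
  have hed' : (ed : ℝ) ≠ 0 := by positivity
  rw [InumPair, zsum_eq, Int.cast_sum, Finset.sum_mul, Finset.sum_div]
  refine Finset.sum_congr rfl fun t ht => ?_
  have htA : t ≤ 2 * C.A := Nat.lt_succ_iff.1 (Finset.mem_range.1 ht)
  rw [coeff_QR_mul, C.simplexFunctional_eq_Zval x y (k + 1) t (2 * C.A - t) (ed + en) ed C.BI hed hB, dI]
  have h1 : C.L (k + 1) + (2 * C.A - t) + (k + 1 + t) = C.L (k + 1) + 2 * C.A + (k + 1) := by omega
  have h2 : (ed : ℝ) ^ (C.L (k + 1) + 2 * C.A + (k + 1)) =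
      (ed : ℝ) ^ (C.L (k + 1) + (2 * C.A - t)) * (ed : ℝ) ^ (k + 1 + t) := by
    rw [← pow_add]; congr 1; omega
  rw [h1, h2, div_pow]
  have h2T : (2 : ℝ) ^ C.T ≠ 0 := by positivity
  have hf1 : ((C.L (k + 1) + 2 * C.A + (k + 1)).factorial : ℝ) ≠ 0 := by positivity
  push_cast
  field_simp

/-! #### The `J`-side per pair -/

/-- Internal arithmetic of the certificate checker (`bw_spec`). [folklore] -/
private theorem bw_spec {u s : ℕ} (hu : u ≤ C.A) (hs : s ≤ C.S) :
    (C.bw u s : ℝ) * ((u + s + 1).factorial : ℝ) =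
      (u.factorial : ℝ) * (s.factorial : ℝ) * ((C.A + C.S + 1).factorial : ℝ) := by
  have hdvd : (u + s + 1).factorial ∣ (C.A + C.S + 1).factorial := Nat.factorial_dvd_factorial (by omega)
  have h : C.bw u s * (u + s + 1).factorial = u.factorial * s.factorial * (C.A + C.S + 1).factorial := by
    rw [bw, mul_assoc, Nat.div_mul_cancel hdvd]
  exact_mod_cast h

/-- `[X^j] T_{g_x} Q_x = Vint_{x,j} / (2^T (A+S+1)!)`. [cite: Polymath8b2014, Lemma 4.4] -/
theorem coeff_convT (x j : ℕ) :
    (convT C.A C.S (C.gR x) (C.QR x)).coeff j =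
      ((C.Vint x j : ℤ) : ℝ) / (2 ^ C.T * ((C.A + C.S + 1).factorial : ℝ)) := by
  rw [convT, Polynomial.finsetSum_coeff, Vint, zsum_eq, Int.cast_sum, Finset.sum_div]
  refine Finset.sum_congr rfl fun u hu => ?_
  rw [Polynomial.finsetSum_coeff, zsum_eq, Int.cast_sum, Finset.sum_div]
  refine Finset.sum_congr rfl fun s hs => ?_
  have hu' := Nat.lt_succ_iff.1 (Finset.mem_range.1 hu)
  have hs' := Nat.lt_succ_iff.1 (Finset.mem_range.1 hs)
  rw [Polynomial.coeff_monomial]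
  split_ifs with h
  · rw [coeff_QR, coeff_gR, coeff_aPoly]
    have hf : ((u + s + 1).factorial : ℝ) ≠ 0 := by positivity
    have hF : ((C.A + C.S + 1).factorial : ℝ) ≠ 0 := by positivity
    have h2 : (2 : ℝ) ^ C.T ≠ 0 := by positivity
    have hb' : (C.bw u s : ℝ) = (u.factorial : ℝ) * (s.factorial : ℝ) * ((C.A + C.S + 1).factorial : ℝ) /
        ((u + s + 1).factorial : ℝ) := by
      rw [eq_div_iff hf]; exact C.bw_spec hu' hs'
    push_cast
    rw [hb']
    field_simp
  · simp

/-- `[(V_xV_y)]_N = VV_{xy,N} / DU`. [cite: Polymath8b2014, Theorem 3.13, eq. (35)] -/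
theorem coeff_convT_mul (x y N : ℕ) :
    (convT C.A C.S (C.gR x) (C.QR x) * convT C.A C.S (C.gR y) (C.QR y)).coeff N =
      ((C.VV x y N : ℤ) : ℝ) / (C.DU : ℝ) := by
  rw [Polynomial.coeff_mul, Finset.Nat.sum_antidiagonal_eq_sum_range_succ_mk, VV, zsum_eq, Int.cast_sum,
    Finset.sum_div]
  refine Finset.sum_congr rfl fun j _ => ?_
  rw [coeff_convT, coeff_convT, DU, Nat.cast_mul, pow2_eq]
  push_cast
  have hf : ((C.A + C.S + 1).factorial : ℝ) ≠ 0 := by positivity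
  have h2 : (2 : ℝ) ^ C.T ≠ 0 := by positivity
  field_simp

/-- `deg V_x ≤ A+S+1`. [cite: Polymath8b2014, Theorem 3.13, eq. (35)] -/
theorem natDegree_convT_le (x : ℕ) : (convT C.A C.S (C.gR x) (C.QR x)).natDegree ≤ C.A + C.S + 1 :=
  Polynomial.natDegree_sum_le_of_forall_le _ _ fun u hu =>
    Polynomial.natDegree_sum_le_of_forall_le _ _ fun _ hs =>
      (Polynomial.natDegree_monomial_le _).trans (by
        have := Finset.mem_range.1 hu; have := Finset.mem_range.1 hs; omega)

/-- `deg (V_xV_y) < Cmax+1`. [cite: Polymath8b2014, Theorem 3.13, eq. (35)] -/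
theorem natDegree_convT_mul_lt (x y : ℕ) :
    (convT C.A C.S (C.gR x) (C.QR x) * convT C.A C.S (C.gR y) (C.QR y)).natDegree < C.Cmax + 1 :=
  Nat.lt_succ_of_le (Polynomial.natDegree_mul_le.trans
    (by have := C.natDegree_convT_le x; have := C.natDegree_convT_le y; rw [Cmax]; omega))

/-- the shifted coefficients: `shiftCoeff (V_xV_y) (Cmax+1) (2en/ed) c = Uint_c / (DU · ed^Cmax)`.
[cite: Polymath8b2014, Lemma 4.4] -/
theorem shiftCoeff_eq_Uint (en ed x y c : ℕ) (hed : 0 < ed) :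
    shiftCoeff (convT C.A C.S (C.gR x) (C.QR x) * convT C.A C.S (C.gR y) (C.QR y)) (C.Cmax + 1)
        (((2 * en : ℕ) : ℝ) / ed) c =
      ((C.Uint en ed x y c : ℤ) : ℝ) / ((C.DU : ℝ) * (ed : ℝ) ^ C.Cmax) := by
  have hed' : (ed : ℝ) ≠ 0 := by positivity
  rw [shiftCoeff, Uint, zsum_eq, Int.cast_sum, Finset.sum_div]
  refine Finset.sum_congr rfl fun N hN => ?_
  have hN : N ≤ C.Cmax := Nat.lt_succ_iff.1 (Finset.mem_range.1 hN)
  rw [coeff_convT_mul]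
  have h2 : (ed : ℝ) ^ C.Cmax = (ed : ℝ) ^ (N - c) * (ed : ℝ) ^ (C.Cmax - (N - c)) := by
    rw [← pow_add]; congr 1; omega
  rw [h2, div_pow]
  push_cast
  field_simp

/-- `Σ_c [(V_xV_y)(X+2ε)]_c Λ_{k,c,(ed-en)/ed}(ĥ^k) = JnumPair · 2^{-2Tk} / (DU ed^Cmax ed^{L+Cmax+k} (L+Cmax+k)!)`.
[cite: Polymath8b2014, Theorem 3.13, eq. (35)] -/
theorem Jpair_eq (k en ed x y : ℕ) (hed : 0 < ed) (hB : C.Hsum x y ^ k < 2 ^ C.BJ) :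
    ∑ c ∈ Finset.range (C.Cmax + 1),
        shiftCoeff (convT C.A C.S (C.gR x) (C.QR x) * convT C.A C.S (C.gR y) (C.QR y)) (C.Cmax + 1)
          (((2 * en : ℕ) : ℝ) / ed) c *
        simplexFunctional k c (((ed - en : ℕ) : ℝ) / ed) (hat (C.gR x * C.gR y) ^ k) =
      ((C.JnumPair k en ed x y : ℤ) : ℝ) * (1 / (2 ^ C.T) ^ 2 : ℝ) ^ k /
        ((C.DU : ℝ) * (ed : ℝ) ^ C.Cmax *
          ((ed : ℝ) ^ (C.L k + C.Cmax + k) * ((C.L k + C.Cmax + k).factorial : ℝ))) := by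
  have hed' : (ed : ℝ) ≠ 0 := by positivity
  rw [JnumPair, zsum_eq, Int.cast_sum, Finset.sum_mul, Finset.sum_div]
  refine Finset.sum_congr rfl fun c hc => ?_
  have hcC : c ≤ C.Cmax := Nat.lt_succ_iff.1 (Finset.mem_range.1 hc)
  rw [C.shiftCoeff_eq_Uint en ed x y c hed,
    C.simplexFunctional_eq_Zval x y k c (C.Cmax - c) (ed - en) ed C.BJ hed hB, dJ]
  have h1 : C.L k + (C.Cmax - c) + (k + c) = C.L k + C.Cmax + k := by omega
  have h2 : (ed : ℝ) ^ (C.L k + C.Cmax + k) = (ed : ℝ) ^ (C.L k + (C.Cmax - c)) * (ed : ℝ) ^ (k + c) := by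
    rw [← pow_add]; congr 1; omega
  rw [h1, h2, div_pow]
  have hDU : (C.DU : ℝ) ≠ 0 := by
    rw [DU, Nat.cast_mul, pow2_eq]; push_cast; positivity
  have h2 : (2 : ℝ) ^ C.T ≠ 0 := by positivity
  have hf1 : ((C.L k + C.Cmax + k).factorial : ℝ) ≠ 0 := by positivity
  push_cast
  field_simp

/-! #### Assembly -/

/-- the certificate's real data. [cite: Polymath8b2014, Theorem 3.13, eq. (35)] -/
noncomputable def D : ProdData (Fin C.J) where
  A := C.A
  S := C.S
  g := fun x => C.gR x
  Q := fun x => C.QR x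
  degg := fun x => C.natDegree_gR_le x
  degQ := fun x => C.natDegree_QR_le x

/-- `0 < DenI`. [cite: Polymath8b2014, Theorem 3.13, eq. (35)] -/
theorem DenI_pos {k ed : ℕ} (hed : 0 < ed) : (0 : ℝ) < C.DenI k ed := by
  rw [DenI, pow2_eq]; push_cast; positivity

/-- `0 < DenJ`. [cite: Polymath8b2014, Theorem 3.13, eq. (35)] -/
theorem DenJ_pos {k ed : ℕ} (hed : 0 < ed) : (0 : ℝ) < C.DenJ k ed := by
  rw [DenJ, DU, pow2_eq]; push_cast; positivity

/-- **Soundness of the product-radial kernel checker**: an accepted certificate yields a Polymath test function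
on `R_{k+1}` with `M_{k+1,ε}(F) > 4`, `ε = en/ed`. [cite: Polymath8b2014, Theorem 3.13, eq. (35)] -/
theorem sound (k en ed : ℕ) (C : ProdCert) (h : ProdCert.check k en ed C = true) :
    ∃ (ε : ℝ) (F : (Fin (k + 1) → ℝ) → ℝ), 0 < ε ∧ ε < 1 ∧ IsPolymathTestFunction (k + 1) ε F ∧
      4 < polymathFunctional (k + 1) ε F := by
  simp only [check, noCarry, Bool.and_eq_true, Nat.blt_eq, decide_eq_true_eq, nall_iff, pow2_eq] at h
  obtain ⟨⟨⟨⟨hen0, hen⟩, hnc⟩, hIpos⟩, hineq⟩ := h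
  have hed : 0 < ed := lt_trans hen0 hen
  have hedR : (0 : ℝ) < ed := by exact_mod_cast hed
  have hε0 : (0 : ℝ) < (en : ℝ) / ed := div_pos (by exact_mod_cast hen0) hedR
  have hε1 : (en : ℝ) / ed < 1 := by rw [div_lt_one hedR]; exact_mod_cast hen
  have hρI : (1 : ℝ) + (en : ℝ) / ed = ((ed + en : ℕ) : ℝ) / ed := by push_cast; field_simp
  have hρJ : (1 : ℝ) - (en : ℝ) / ed = ((ed - en : ℕ) : ℝ) / ed := by
    rw [Nat.cast_sub hen.le]; field_simp
  have hd : (2 : ℝ) * ((en : ℝ) / ed) = ((2 * en : ℕ) : ℝ) / ed := by push_cast; ring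
  -- the two closed forms
  have hIform : ∑ x : Fin C.J, ∑ y : Fin C.J, ∑ t ∈ Finset.range (2 * C.A + 1),
        (C.QR x * C.QR y).coeff t *
          simplexFunctional (k + 1) t (1 + (en : ℝ) / ed) (hat (C.gR x * C.gR y) ^ (k + 1)) =
      ((C.Inum k en ed : ℤ) : ℝ) * (1 / (2 ^ C.T) ^ 2 : ℝ) ^ (k + 1) /
        ((ed : ℝ) ^ (C.L (k + 1) + 2 * C.A + (k + 1)) * ((C.L (k + 1) + 2 * C.A + (k + 1)).factorial : ℝ)) := by
    rw [hρI, Inum, zsum_eq, Int.cast_sum, Finset.sum_mul, Finset.sum_div, ← Fin.sum_univ_eq_sum_range]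
    refine Finset.sum_congr rfl fun x _ => ?_
    rw [zsum_eq, Int.cast_sum, Finset.sum_mul, Finset.sum_div, ← Fin.sum_univ_eq_sum_range]
    refine Finset.sum_congr rfl fun y _ => ?_
    exact C.Ipair_eq k en ed x y hed (hnc x x.isLt y y.isLt).1
  have hJform : ∑ x : Fin C.J, ∑ y : Fin C.J, ∑ c ∈ Finset.range (C.Cmax + 1),
        shiftCoeff (convT C.A C.S (C.gR x) (C.QR x) * convT C.A C.S (C.gR y) (C.QR y))
          (C.Cmax + 1) (2 * ((en : ℝ) / ed)) c *
          simplexFunctional k c (1 - (en : ℝ) / ed) (hat (C.gR x * C.gR y) ^ k) =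
      ((C.Jnum k en ed : ℤ) : ℝ) * (1 / (2 ^ C.T) ^ 2 : ℝ) ^ k /
        ((C.DU : ℝ) * (ed : ℝ) ^ C.Cmax *
          ((ed : ℝ) ^ (C.L k + C.Cmax + k) * ((C.L k + C.Cmax + k).factorial : ℝ))) := by
    rw [hρJ, hd, Jnum, zsum_eq, Int.cast_sum, Finset.sum_mul, Finset.sum_div, ← Fin.sum_univ_eq_sum_range]
    refine Finset.sum_congr rfl fun x _ => ?_
    rw [zsum_eq, Int.cast_sum, Finset.sum_mul, Finset.sum_div, ← Fin.sum_univ_eq_sum_range]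
    refine Finset.sum_congr rfl fun y _ => ?_
    exact C.Jpair_eq k en ed x y hed (hnc x x.isLt y y.isLt).2
  -- the two values as Inum/DenI and Jnum/DenJ
  have h2 : (2 : ℝ) ^ C.T ≠ 0 := by positivity
  have hedn : (ed : ℝ) ≠ 0 := hedR.ne'
  have hDIe : ((C.Inum k en ed : ℤ) : ℝ) * (1 / (2 ^ C.T) ^ 2 : ℝ) ^ (k + 1) /
        ((ed : ℝ) ^ (C.L (k + 1) + 2 * C.A + (k + 1)) * ((C.L (k + 1) + 2 * C.A + (k + 1)).factorial : ℝ)) =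
      (C.Inum k en ed : ℝ) / (C.DenI k ed : ℝ) := by
    rw [DenI, Nat.cast_mul, Nat.cast_mul, pow2_eq]
    have hf : ((C.L (k + 1) + 2 * C.A + (k + 1)).factorial : ℝ) ≠ 0 := by positivity
    rw [one_div_pow]
    push_cast
    field_simp
    ring
  have hDJe : ((C.Jnum k en ed : ℤ) : ℝ) * (1 / (2 ^ C.T) ^ 2 : ℝ) ^ k /
        ((C.DU : ℝ) * (ed : ℝ) ^ C.Cmax *
          ((ed : ℝ) ^ (C.L k + C.Cmax + k) * ((C.L k + C.Cmax + k).factorial : ℝ))) =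
      (C.Jnum k en ed : ℝ) / (C.DenJ k ed : ℝ) := by
    rw [DenJ, DU, Nat.cast_mul, Nat.cast_mul, Nat.cast_mul, Nat.cast_mul, Nat.cast_mul, pow2_eq]
    have hf : ((C.L k + C.Cmax + k).factorial : ℝ) ≠ 0 := by positivity
    have hF : ((C.A + C.S + 1).factorial : ℝ) ≠ 0 := by positivity
    rw [one_div_pow]
    push_cast
    field_simp
    ring
  have hDIp := C.DenI_pos (k := k) hed
  have hDJp := C.DenJ_pos (k := k) hed
  have hIposR : (0 : ℝ) < (C.Inum k en ed : ℝ) / (C.DenI k ed : ℝ) :=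
    div_pos (by exact_mod_cast hIpos) hDIp
  have hineqR : (4 : ℝ) * (C.Inum k en ed : ℝ) * (C.DenJ k ed : ℝ) <
      ((k + 1 : ℕ) : ℝ) * (C.Jnum k en ed : ℝ) * (C.DenI k ed : ℝ) := by exact_mod_cast hineq
  have hcert : 4 * ((C.Inum k en ed : ℝ) / (C.DenI k ed : ℝ)) <
      (k + 1 : ℝ) * ((C.Jnum k en ed : ℝ) / (C.DenJ k ed : ℝ)) := by
    have hDIn := hDIp.ne'
    have hDJn := hDJp.ne'
    rw [show 4 * ((C.Inum k en ed : ℝ) / (C.DenI k ed : ℝ)) =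
        (4 * (C.Inum k en ed : ℝ) * C.DenJ k ed) / ((C.DenI k ed : ℝ) * C.DenJ k ed) by field_simp,
      show (k + 1 : ℝ) * ((C.Jnum k en ed : ℝ) / (C.DenJ k ed : ℝ)) =
        (((k + 1 : ℕ) : ℝ) * (C.Jnum k en ed : ℝ) * C.DenI k ed) / ((C.DenI k ed : ℝ) * C.DenJ k ed) by
          push_cast; field_simp]
    exact div_lt_div_of_pos_right hineqR (mul_pos hDIp hDJp)
  obtain ⟨F, hF, hM⟩ := C.D.exists_polymathFunctional_gt_four k hε0 hε1
    (BI := 2 * C.A + 1) (BJ := C.Cmax + 1) (fun x y => C.natDegree_QR_mul_lt x y)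
    (fun x y => C.natDegree_convT_mul_lt x y) (hIform.trans hDIe) (hJform.trans hDJe) hIposR hcert
  exact ⟨(en : ℝ) / ed, F, hε0, hε1, hF, hM⟩

/-- **Soundness, tabulated form**: per-pair kernel facts `InumPair = tI`, `JnumPair = tJ` (a `pall` conjunction,
one `decide +kernel` per pair and side) and `checkTab = true` give a test function with `M_{k+1,ε} > 4`.
[cite: Polymath8b2014, Theorem 3.13, eq. (35)] -/
theorem sound_tab (k en ed J₀ : ℕ) (C : ProdCert) (tI tJ : ℕ → ℕ → ℤ) (hJ : C.J = J₀)
    (hP : pall (fun x => pall (fun y => C.InumPair k en ed x y = tI x y ∧ C.JnumPair k en ed x y = tJ x y) J₀) J₀)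
    (h : ProdCert.checkTab k en ed C tI tJ = true) :
    ∃ (ε : ℝ) (F : (Fin (k + 1) → ℝ) → ℝ), 0 < ε ∧ ε < 1 ∧ IsPolymathTestFunction (k + 1) ε F ∧
      4 < polymathFunctional (k + 1) ε F :=
  sound k en ed C (check_of_checkTab k en ed J₀ C tI tJ hJ hP h)

end Spec

end ProdCert

end Literature.NumberTheory.Sieve.PolymathCert
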